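import Mathlib.GroupTheory.OrderOfElement
import Literature.AnabelianGeometry.SemiGraphs.CosetCategories
import HarnessLib

/-!
# The coset category `𝓑(G)⁰` of a compact group: finite hom-sets and finite automorphism groups

Mochizuki, *The geometry of Frobenioids II*, Kyushu J. Math. **62** (2008), Example 1.3 (i) p. 11 (the
category of connected objects of the Galois category `𝓑(G)` of a profinite group `G` = finite sets with
transitive continuous `G`-action) [cite: MochizukiFrdII2008, Ex 1.3 (i) p.11]; used in [EtTh] §3 as the
constant-field category `D^cnst := 𝓑(Spec K)⁰ ≃ 𝓑(G_K)⁰` (PRIMS **45** (2009), PDF p. 72: "`D^cnst := B(Spec K)⁰`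
— where the superscript '0' denotes the full subcategory constituted by the connected objects"), whose objects
`Spec L` have the FINITE automorphism groups `Aut(L/K)`.

Proof-only companion (theorems only, no definitions, no instances; cell abc-iut, seat abc-iut-w5-d250 gen 3) of
abc-iut-L5-t2's `CosetCategories.lean` (`CosetCat G`: objects the open subgroups `U ⊆ G` standing for the
transitive `G`-sets `G/U`, morphisms the `G`-equivariant maps, each determined by the image `pt f ∈ G/V` of the
coset `1·U`, `CosetCat.hom_ext`).  For `G` COMPACT (e.g. profinite: `G_K`) an open subgroup has finite index
(Mathlib: `Finite (G ⧸ U)`), so: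
* `CosetCat.finite_hom` — every hom-set `Hom(G/U, G/V) ↪ G/V` is finite;
* `CosetCat.finite_aut` — every automorphism group `Aut(G/U) (≅ N_G(U)/U)` is finite;
* `CosetCat.isOfFinOrder_aut` — hence every automorphism of an object of `𝓑(G)⁰` has finite order.
The last is the hypothesis `hfin` of `TemperedFrobenioid.thm37_ii_ratStd_treeCatVocab_of_cnst'`
(`EtaleTheta/Discharge/Sec3Thm37RatStdOfCnst.lean`: [EtTh] Thm. 3.7 (ii), second clause) at the intended
constant-field category `D^cnst := 𝓑(G_K)⁰`.  Pure topological-group / category theory over Mathlib; nothing of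
the disputed series is asserted.
-/

namespace Literature.AnabelianGeometry.SemiGraphs

namespace CosetCat

open CategoryTheory

universe u

variable {G : Type u} [Group G] [TopologicalSpace G]

/-- A morphism `G/U → G/V` of the coset category is determined by the image of the coset `1·U`: `pt` is
injective on `Hom(G/U, G/V)`. [cite: MochizukiFrdII2008, Ex 1.3 (i) p.11] -/
theorem pt_injective (X Y : CosetCat G) : Function.Injective (pt : (X ⟶ Y) → Y.carrier) :=
  fun _ _ h => hom_ext h

/-- **Hom-sets of `𝓑(G)⁰` are finite for compact `G`**: `Hom(G/U, G/V)` embeds into the finite set `G/V` (an open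
subgroup of a compact group has finite index). [cite: MochizukiFrdII2008, Ex 1.3 (i) p.11] -/
theorem finite_hom [SeparatelyContinuousMul G] [CompactSpace G] (X Y : CosetCat G) : Finite (X ⟶ Y) :=
  Finite.of_injective pt (pt_injective X Y)

/-- **Automorphism groups of `𝓑(G)⁰` are finite for compact `G`** (`Aut(G/U) ≅ N_G(U)/U`; for `G = G_K` and
`D^cnst = 𝓑(G_K)⁰`: `Aut_{D^cnst}(Spec L) = Aut(L/K)` is finite). [cite: MochizukiFrdII2008, Ex 1.3 (i) p.11] -/
theorem finite_aut [SeparatelyContinuousMul G] [CompactSpace G] (X : CosetCat G) : Finite (Aut X) :=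
  haveI := finite_hom X X
  Finite.of_injective Iso.hom fun _ _ h => Iso.ext h

/-- **Every automorphism of an object of `𝓑(G)⁰`, `G` compact, has finite order** — the hypothesis `hfin` of
`TemperedFrobenioid.thm37_ii_ratStd_treeCatVocab_of_cnst'` ([EtTh] Thm. 3.7 (ii)) at `D^cnst := 𝓑(G_K)⁰`.
[cite: MochizukiFrdII2008, Ex 1.3 (i) p.11] -/
theorem isOfFinOrder_aut [SeparatelyContinuousMul G] [CompactSpace G] (X : CosetCat G) (φ : Aut X) :
    IsOfFinOrder φ :=
  haveI := finite_aut X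
  isOfFinOrder_of_finite φ

end CosetCat

end Literature.AnabelianGeometry.SemiGraphs
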